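/-
Copyright (c) 2026. All rights reserved.
Released under Apache 2.0 license as described in the file LICENSE.
-/
import Literature.NumberTheory.Weil1964.AdelicSchrodingerConj
import Literature.NumberTheory.Weil1964.AdelicMetaplecticContinuous
import HarnessLib

/-!
# Complex conjugation on the metaplectic group of record: `Mp_ψ(W_T)ᶜᵒⁿᵗ ≃* Mp_ψ(W_{−T})ᶜᵒⁿᵗ`

Topic `NumberTheory/Weil1964`; namespace `Literature.NumberTheory.Weil1964`.  KERNEL MATHEMATICS ONLY: no
`def … : Prop` record of a published theorem, no `axiom`, no proof hole; every tag is provenance for a kernel-checked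
statement.  Origin: `pub-hodgecm` SEAMS sprint, site S4-10 kernel item (a), second half: the conjugate model
`(g, M) ↦ (g, C M C)` of `AdelicSchrodingerConj.lean` (`adelicMpConj : Mp_ψ(W_T) ≃* Mp_ψ(W_{−T})` on ALL implementing
pairs) RESTRICTED TO THE GROUP OF RECORD `Mp_ψ(W_𝔸)ᶜᵒⁿᵗ = adelicMpCont` of `AdelicMetaplecticContinuous.lean` (pairs
whose operator and inverse operator are LF-continuous on `𝒮(𝔸_F^ι) = 𝓢(X_∞) ⊗ 𝒮(X_f)`).

WHAT IS HERE (all proved):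
* §1 complex conjugation on the two tensor factors: `schwartzConj : 𝓢(X_∞) →L[ℝ] 𝓢(X_∞)` (Mathlib's
  `SchwartzMap.postcompCLM` of the real-linear isometry `Complex.conjCLE`), the `ℂ`-linear continuous sandwich
  `schwartzConjConj A = C A C` of a continuous `ℂ`-linear `A`, `finSBConj` on `𝒮(X_f)`, and the factorisation
  `C (φ ⊗ Φ_f) = φ̄ ⊗ Φ̄_f` (`piSchwartzBruhatConj_equiv_tmul`).
* §2 **LF-CONTINUITY IS PRESERVED BY CONJUGATION OF OPERATORS**: if `M (φ ⊗ Φ_f) = ∑ A_j φ ⊗ Ψ_j` on the piece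
  through `Φ_f` then `(C M C)(φ ⊗ Φ_f) = ∑ (C A_j C) φ ⊗ Ψ̄′_j` with the expansion of `M` at `Φ̄_f`
  (`isLFContinuous_slConj`); hence `C M C ∈ GL(𝒮)ᶜᵒⁿᵗ ↔ M ∈ GL(𝒮)ᶜᵒⁿᵗ` (`slConj_mem_lfUnits_iff`).
* §3 THE CONJUGATE MODEL ON THE GROUP OF RECORD: `pᶜ ∈ Mp_ψ(W_{−T})ᶜᵒⁿᵗ ↔ p ∈ Mp_ψ(W_T)ᶜᵒⁿᵗ`
  (`adelicMpConj_mem_adelicMpCont_iff`) and **`adelicMpContConj F ι T : adelicMpCont F ι T ≃* adelicMpCont F ι (-T)`**,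
  `(g, M) ↦ (g, C M C)`, covering the identity of `Sp(W_T)(𝔸) = Sp(W_{−T})(𝔸) ≤ GL(W_𝔸)`
  (`coe_proj_adelicMpContConj`), with `ω_{−T}(pᶜ) Ψ = C (ω_T(p) (C Ψ))` for the Weil representation of record
  `adelicMpCont.omega` (`adelicMpCont.omega_adelicMpContConj_apply`) and preservation of `Θ`-fixing
  (`adelicMpContConj_mem_adelicMpTheta_iff`), and `Θ(ω_{−T}(pᶜ) Φ̄) = conj Θ(ω_T(p) Φ)`
  (`thetaDist_omega_adelicMpContConj`).

WHAT IS NOT HERE: (i) the relation between the rational lifts `r_T`, `r_{−T}` of `AdelicMetaplecticRationalLift.lean`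
under `p ↦ pᶜ` (a `T`-dependent Darboux bookkeeping, not needed by site S4-10); (ii) continuity of `p ↦ pᶜ` for the
topology of `AdelicMetaplecticGroup.lean` §4; (iii) anything about the diagonal embedding `δ_F`
(`DoublingDiagonalPolarisation.lean`) or the kernel identity of `AdelicThetaDiagonalKernel.lean`.

Sources.  [Weil1964] A. Weil, Sur certains groupes d'opérateurs unitaires, Acta Math. 111 (1964), Chap. I n° 11–13
pp. 155–160 (the operators of the metaplectic group are automorphisms of the topological vector space `𝒮(X)`);
[Li1992] J.-S. Li, J. reine angew. Math. 428 (1992), p. 181 (`ω*` = the complex conjugate `ω_{ψ̄}`);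
[MoeglinVignerasWaldspurger1987] Chap. 2 II.1 (transport of structure for `S̃p_ψ(W)`).  All statements tagged
`[folklore]` are routine verifications on the tree's definitions.
-/

set_option autoImplicit false

noncomputable section

open scoped TensorProduct ComplexConjugate Classical

namespace Literature.NumberTheory.Weil1964

open Literature.RepresentationTheory.HeisenbergGroup Literature.NumberTheory.Automorphic NumberField
  NumberField.mixedEmbedding IsDedekindDomain TensorProduct

/-! ## §1 Complex conjugation on the tensor factors `𝓢(X_∞)` and `𝒮(X_f)` -/

section Factors

variable {K : Type} [Field K] [NumberField K] {ι : Type}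

/-- complex conjugation `Φ_f ↦ Φ̄_f` on `𝒮(X_f)` (locally constant of compact support is preserved). [folklore] -/
def finSBConj (Φ : FinSB K ι) : FinSB K ι :=
  ⟨star (Φ : (ι → FiniteAdeleRing (𝓞 K) K) → ℂ),
    mem_schwartzBruhat_iff.2 ⟨(mem_schwartzBruhat_iff.1 Φ.2).1.comp (star : ℂ → ℂ),
      (mem_schwartzBruhat_iff.1 Φ.2).2.comp_left (g := (star : ℂ → ℂ)) (star_zero ℂ)⟩⟩

/-- underlying function. [folklore] -/
@[simp] theorem coe_finSBConj (Φ : FinSB K ι) :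
    ((finSBConj Φ : FinSB K ι) : (ι → FiniteAdeleRing (𝓞 K) K) → ℂ) =
      star (Φ : (ι → FiniteAdeleRing (𝓞 K) K) → ℂ) :=
  rfl

variable [Fintype ι]

/-- complex conjugation `φ ↦ φ̄` of archimedean Schwartz functions, a REAL-linear continuous map (Mathlib's
`SchwartzMap.postcompCLM` of `Complex.conjCLE`). [folklore] -/
def schwartzConj : SchwartzMap (ι → mixedSpace K) ℂ →L[ℝ] SchwartzMap (ι → mixedSpace K) ℂ :=
  SchwartzMap.postcompCLM (𝕜 := ℝ) (Complex.conjCLE : ℂ →L[ℝ] ℂ)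

/-- pointwise formula. [folklore] -/
@[simp] theorem schwartzConj_apply (φ : SchwartzMap (ι → mixedSpace K) ℂ) (x : ι → mixedSpace K) :
    schwartzConj φ x = conj (φ x) :=
  rfl

/-- `C (C φ) = φ`. [folklore] -/
@[simp] theorem schwartzConj_schwartzConj (φ : SchwartzMap (ι → mixedSpace K) ℂ) :
    schwartzConj (schwartzConj φ) = φ := by
  ext x
  rw [schwartzConj_apply, schwartzConj_apply, Complex.conj_conj]

/-- `C (c • φ) = c̄ • C φ`. [folklore] -/
theorem schwartzConj_smul (c : ℂ) (φ : SchwartzMap (ι → mixedSpace K) ℂ) :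
    schwartzConj (c • φ) = conj c • schwartzConj φ := by
  ext x
  change conj (c * φ x) = conj c * conj (φ x)
  exact map_mul _ _ _

/-- the sandwich `C A C` of a continuous `ℂ`-linear operator `A` of `𝓢(X_∞)`: `ℂ`-linear and continuous again.
[folklore] -/
def schwartzConjConj (A : SchwartzMap (ι → mixedSpace K) ℂ →L[ℂ] SchwartzMap (ι → mixedSpace K) ℂ) :
    SchwartzMap (ι → mixedSpace K) ℂ →L[ℂ] SchwartzMap (ι → mixedSpace K) ℂ where
  toFun φ := schwartzConj (A (schwartzConj φ))
  map_add' φ ψ := by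
    change schwartzConj (A (schwartzConj (φ + ψ))) = schwartzConj (A (schwartzConj φ)) + schwartzConj (A (schwartzConj ψ))
    simp only [map_add]
  map_smul' c φ := by
    change schwartzConj (A (schwartzConj (c • φ))) = c • schwartzConj (A (schwartzConj φ))
    rw [schwartzConj_smul, map_smul, schwartzConj_smul, Complex.conj_conj]
  cont := schwartzConj.continuous.comp (A.continuous.comp schwartzConj.continuous)

/-- pointwise formula. [folklore] -/
@[simp] theorem schwartzConjConj_apply (A : SchwartzMap (ι → mixedSpace K) ℂ →L[ℂ] SchwartzMap (ι → mixedSpace K) ℂ)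
    (φ : SchwartzMap (ι → mixedSpace K) ℂ) : schwartzConjConj A φ = schwartzConj (A (schwartzConj φ)) :=
  rfl

variable (K ι) in
/-- **`C (φ ⊗ Φ_f) = φ̄ ⊗ Φ̄_f`**: complex conjugation of `𝒮(𝔸_K^ι)` factors through the tensor decomposition.
[folklore] -/
theorem piSchwartzBruhatConj_equiv_tmul (φ : SchwartzMap (ι → mixedSpace K) ℂ) (Φ : FinSB K ι) :
    piSchwartzBruhatConj K ι (piSchwartzBruhatEquiv K ι (φ ⊗ₜ Φ)) =
      piSchwartzBruhatEquiv K ι (schwartzConj φ ⊗ₜ finSBConj Φ) := by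
  apply Subtype.ext
  rw [coe_piSchwartzBruhatConj, coe_piSchwartzBruhatEquiv_tmul, coe_piSchwartzBruhatEquiv_tmul]
  funext v
  rw [Pi.star_apply, star_mul', schwartzConj_apply, coe_finSBConj, Pi.star_apply, Complex.star_def]

end Factors

/-! ## §2 LF-continuity is preserved by conjugation of operators -/

section LF

variable {K : Type} [Field K] [NumberField K] {ι : Type} [Fintype ι]

/-- `(C M C)⁻¹ = C M⁻¹ C`. [folklore] -/
theorem slConj_piSchwartzBruhatConj_symm (M : ↥(piSchwartzBruhat K ι) ≃ₗ[ℂ] ↥(piSchwartzBruhat K ι)) :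
    (slConj (piSchwartzBruhatConj K ι) M).symm = slConj (piSchwartzBruhatConj K ι) M.symm :=
  LinearEquiv.ext fun _ => rfl

/-- `C (C M C) C = M`. [folklore] -/
@[simp] theorem slConj_piSchwartzBruhatConj_slConj (M : ↥(piSchwartzBruhat K ι) ≃ₗ[ℂ] ↥(piSchwartzBruhat K ι)) :
    slConj (piSchwartzBruhatConj K ι) (slConj (piSchwartzBruhatConj K ι) M) = M :=
  LinearEquiv.ext fun Φ => by
    rw [slConj_apply, slConj_apply, piSchwartzBruhatConj_symm, piSchwartzBruhatConj_piSchwartzBruhatConj,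
      piSchwartzBruhatConj_piSchwartzBruhatConj]

/-- **LF-CONTINUITY IS PRESERVED BY COMPLEX CONJUGATION OF OPERATORS**: if `M` has the finite continuous expansion
`M (φ ⊗ Φ̄_f) = ∑ A_j φ ⊗ Ψ_j` on the piece through `Φ̄_f`, then `(C M C)(φ ⊗ Φ_f) = ∑ (C A_j C) φ ⊗ Ψ̄_j` on the
piece through `Φ_f`, and `C A_j C` is continuous `ℂ`-linear. [cite: Weil1964, Chap. I n° 11 pp. 155–156] -/
theorem isLFContinuous_slConj {M : ↥(piSchwartzBruhat K ι) ≃ₗ[ℂ] ↥(piSchwartzBruhat K ι)}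
    (hM : IsLFContinuous (M : ↥(piSchwartzBruhat K ι) →ₗ[ℂ] ↥(piSchwartzBruhat K ι))) :
    IsLFContinuous ((slConj (piSchwartzBruhatConj K ι) M : ↥(piSchwartzBruhat K ι) ≃ₗ[ℂ] ↥(piSchwartzBruhat K ι)) :
      ↥(piSchwartzBruhat K ι) →ₗ[ℂ] ↥(piSchwartzBruhat K ι)) := by
  intro Φf
  obtain ⟨κ, _, A, Ψ, h⟩ := hM (finSBConj Φf)
  refine ⟨κ, inferInstance, fun j => schwartzConjConj (A j), fun j => finSBConj (Ψ j), fun φ => ?_⟩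
  change piSchwartzBruhatConj K ι ((M : ↥(piSchwartzBruhat K ι) →ₗ[ℂ] ↥(piSchwartzBruhat K ι))
    ((piSchwartzBruhatConj K ι).symm (piSchwartzBruhatEquiv K ι (φ ⊗ₜ Φf)))) =
    ∑ j, piSchwartzBruhatEquiv K ι (schwartzConjConj (A j) φ ⊗ₜ finSBConj (Ψ j))
  rw [piSchwartzBruhatConj_symm, piSchwartzBruhatConj_equiv_tmul, h, map_sum]
  exact Finset.sum_congr rfl fun j _ => by rw [piSchwartzBruhatConj_equiv_tmul, schwartzConjConj_apply]

/-- **`C M C ∈ GL(𝒮)ᶜᵒⁿᵗ` when `M ∈ GL(𝒮)ᶜᵒⁿᵗ`.** [folklore] -/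
theorem slConj_mem_lfUnits {M : ↥(piSchwartzBruhat K ι) ≃ₗ[ℂ] ↥(piSchwartzBruhat K ι)} (hM : M ∈ lfUnits K ι) :
    slConj (piSchwartzBruhatConj K ι) M ∈ lfUnits K ι :=
  ⟨isLFContinuous_slConj hM.1, by
    rw [slConj_piSchwartzBruhatConj_symm]
    exact isLFContinuous_slConj hM.2⟩

/-- **`C M C ∈ GL(𝒮)ᶜᵒⁿᵗ ↔ M ∈ GL(𝒮)ᶜᵒⁿᵗ`.** [folklore] -/
theorem slConj_mem_lfUnits_iff (M : ↥(piSchwartzBruhat K ι) ≃ₗ[ℂ] ↥(piSchwartzBruhat K ι)) :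
    slConj (piSchwartzBruhatConj K ι) M ∈ lfUnits K ι ↔ M ∈ lfUnits K ι :=
  ⟨fun h => by simpa only [slConj_piSchwartzBruhatConj_slConj] using slConj_mem_lfUnits h, slConj_mem_lfUnits⟩

end LF

/-! ## §3 The conjugate model on the group of record `Mp_ψ(W_𝔸)ᶜᵒⁿᵗ` -/

section Adelic

variable {F : Type} [Field F] [NumberField F] {ι : Type} [Fintype ι] [DecidableEq ι]
  {T : Matrix ι ι (AdeleRing (𝓞 F) F)}

/-- **the conjugate pair is of record iff the pair is**: `pᶜ ∈ Mp_ψ(W_{−T})ᶜᵒⁿᵗ ↔ p ∈ Mp_ψ(W_T)ᶜᵒⁿᵗ`.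
[cite: Weil1964, Chap. I n° 11–13 pp. 155–160] -/
theorem adelicMpConj_mem_adelicMpCont_iff (p : adelicMp F ι T) :
    adelicMpConj F ι T p ∈ adelicMpCont F ι (-T) ↔ p ∈ adelicMpCont F ι T := by
  rw [mem_adelicMpCont_iff, mem_adelicMpCont_iff, toOp_adelicMpConj, slConj_mem_lfUnits_iff]

variable (F ι T) in
/-- **`Mp_ψ(W_T)ᶜᵒⁿᵗ ≃* Mp_ψ(W_{−T})ᶜᵒⁿᵗ`, `(g, M) ↦ (g, C M C)`** — the complex-conjugate model on the metaplectic
group OF RECORD (restriction of `adelicMpConj`). [cite: Li1992, p. 181; MoeglinVignerasWaldspurger1987, Chap. 2 II.1] -/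
def adelicMpContConj : adelicMpCont F ι T ≃* adelicMpCont F ι (-T) where
  toFun p := ⟨adelicMpConj F ι T p, (adelicMpConj_mem_adelicMpCont_iff _).2 p.2⟩
  invFun q := ⟨(adelicMpConj F ι T).symm q, by
    rw [← adelicMpConj_mem_adelicMpCont_iff, MulEquiv.apply_symm_apply]
    exact q.2⟩
  left_inv p := Subtype.ext ((adelicMpConj F ι T).symm_apply_apply _)
  right_inv q := Subtype.ext ((adelicMpConj F ι T).apply_symm_apply _)
  map_mul' p q := Subtype.ext (map_mul (adelicMpConj F ι T) _ _)

/-- underlying pair: `(pᶜ : Mp_ψ(W_{−T})) = adelicMpConj p`. [folklore] -/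
@[simp] theorem coe_adelicMpContConj (p : adelicMpCont F ι T) :
    ((adelicMpContConj F ι T p : adelicMpCont F ι (-T)) : adelicMp F ι (-T)) = adelicMpConj F ι T p :=
  rfl

/-- underlying pair of the inverse. [folklore] -/
@[simp] theorem coe_adelicMpContConj_symm (q : adelicMpCont F ι (-T)) :
    (((adelicMpContConj F ι T).symm q : adelicMpCont F ι T) : adelicMp F ι T) = (adelicMpConj F ι T).symm q :=
  rfl

/-- **`π(pᶜ) = π(p)` in `GL(W_𝔸)`** on the group of record. [cite: MoeglinVignerasWaldspurger1987, Chap. 2 II.1 (B)] -/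
theorem coe_proj_adelicMpContConj (p : adelicMpCont F ι T) :
    ((adelicMpCont.proj F ι (-T) (adelicMpContConj F ι T p) : symplecticGroup (polar (adelicForm F ι (-T)))) :
        ((ι → AdeleRing (𝓞 F) F) × (ι → AdeleRing (𝓞 F) F)) ≃ₗ[AdeleRing (𝓞 F) F]
          ((ι → AdeleRing (𝓞 F) F) × (ι → AdeleRing (𝓞 F) F))) =
      (adelicMpCont.proj F ι T p : symplecticGroup (polar (adelicForm F ι T))) :=
  -- a direct term: `rw [adelicMpCont.proj_apply]` would make `kabstract` compare the `T` and `−T` instances of the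
  -- pattern and time out in `isDefEq` on adelic negation.
  coe_proj_adelicMpConj (p : adelicMp F ι T)

/-- **`ω_{−T}(pᶜ) Ψ = C (ω_T(p) (C Ψ))` for the Weil representation of record** `adelicMpCont.omega`.
[cite: Li1992, p. 181] -/
theorem adelicMpCont.omega_adelicMpContConj_apply (p : adelicMpCont F ι T) (Ψ : piSchwartzBruhat F ι) :
    adelicMpCont.omega F ι (-T) (adelicMpContConj F ι T p) Ψ =
      piSchwartzBruhatConj F ι (adelicMpCont.omega F ι T p (piSchwartzBruhatConj F ι Ψ)) :=
  omegaPsi_adelicMpConj_apply (p : adelicMp F ι T) Ψ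

/-- the operator of record of `pᶜ` is `C ω_T(p) C`. [folklore] -/
theorem adelicMpCont.omega_adelicMpContConj (p : adelicMpCont F ι T) :
    adelicMpCont.omega F ι (-T) (adelicMpContConj F ι T p) =
      ((slConj (piSchwartzBruhatConj F ι) (MpPsi.toOp (adelicSchrodinger F ι T) p) :
        piSchwartzBruhat F ι ≃ₗ[ℂ] piSchwartzBruhat F ι) : piSchwartzBruhat F ι →ₗ[ℂ] piSchwartzBruhat F ι) := by
  rw [adelicMpCont.omega_apply, coe_adelicMpContConj, ← toOp_adelicMpConj]
  rfl

/-- **`Θ`-fixing is preserved on the group of record**: `pᶜ ∈ Mp_ψ(W_{−T})^Θ ↔ p ∈ Mp_ψ(W_T)^Θ`.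
[cite: Weil1964, Chap. III n° 41 Thm 6 p. 193] -/
theorem adelicMpContConj_mem_adelicMpTheta_iff (p : adelicMpCont F ι T) :
    ((adelicMpContConj F ι T p : adelicMpCont F ι (-T)) : adelicMp F ι (-T)) ∈ adelicMpTheta F ι (-T) ↔
      (p : adelicMp F ι T) ∈ adelicMpTheta F ι T :=
  adelicMpConj_mem_adelicMpTheta_iff (p : adelicMp F ι T)

/-- **theta-kernel conjugation on the group of record**: `Θ(ω_{−T}(pᶜ) Φ̄) = conj Θ(ω_T(p) Φ)`.
[cite: Li1992, (11)–(15) pp. 181–182] -/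
theorem thetaDist_omega_adelicMpContConj (p : adelicMpCont F ι T) (Φ : piSchwartzBruhat F ι) :
    thetaDist F ι (adelicMpCont.omega F ι (-T) (adelicMpContConj F ι T p) (piSchwartzBruhatConj F ι Φ) :
        (ι → AdeleRing (𝓞 F) F) → ℂ) =
      conj (thetaDist F ι (adelicMpCont.omega F ι T p Φ : (ι → AdeleRing (𝓞 F) F) → ℂ)) :=
  thetaDist_toOp_adelicMpConj (p : adelicMp F ι T) Φ

end Adelic

end Literature.NumberTheory.Weil1964
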